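import Summits.BirchSwinnertonDyer.BirchSwinnertonDyer.Theorems.PrintCf2SplitBadTwoNormAtVbarTwistedTransfer
import Summits.BirchSwinnertonDyer.BirchSwinnertonDyer.Theorems.PrintCf2SplitBadTwoNormAtVbarTwistedKummer
import Summits.BirchSwinnertonDyer.BirchSwinnertonDyer.Theorems.PrintCf2SplitBadTwoNormAtVbarTwistedValuation
import Summits.BirchSwinnertonDyer.BirchSwinnertonDyer.Theorems.PrintCf2SplitBadTwoTwistedLayerField
import Summits.BirchSwinnertonDyer.BirchSwinnertonDyer.Theorems.PrintCf2SplitBadTwoKummerUNonSplitValuation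
import Literature.NumberTheory.NumberFields.UnramifiedCompositum
import HarnessLib

/-!
# Crux `PrintCf2.SplitBadTwoRankOneOfFacts` (stmt-BirchSwinnertonDyer-20368), skeleton v13.5, (REG₂) `stub_xRegular_two` FACT-FREE road, R2 brick
# **B5-T ASSEMBLED: the twisted `v̄`-reading `hB5` of B3d′ in case (B1)** — for a sign `ε` TRIVIAL ON THE DECOMPOSITION GROUP `D_v̄`, the
# `v̄`-clause of the dual-Shapiro class of a layer class forces `p^M ∣ ord_{w′}(b′)` at EVERY place `w′ ∣ v̄` of `F′ = F·K_ε`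

Cell `bsd-print-cf2`, EXTRA WIDTH seat `bsd-line-cf2-p1-w4` g14 (prover-bsd-line-cf2-p1-w4-g14-0); `--supports stmt-BirchSwinnertonDyer-20368`
(helper, Theses-free). HONEST FRAMING: nothing here closes the crux or a registered stub; BSD is not proved by any of this; no summit
statement is proved by this seat. No definition, no named fact, no `sorry`. UNCONDITIONAL.

WHY. -w8 g5's B3d′ `LayerShapiro.exists_level_levelSurj_of_classProNull_twisted` (the twisted twin of B3d; (SUR_U) at a pair of levels for
SIGN-TWISTED coefficients, hence (LSₙ,₂) for every quadratic `θ` via B3c and -w2 g14's socket) displays ONE local input `hB5`: «clause (iii) of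
B2d at `v̄` ⟹ at every place `w′ ∣ v̄` of `F′`, `p^M ∣ ord_{w′}(b′)` OR `w′` is not split over `F`». At the places NOT split over `F` the right
disjunct holds (p705557); when `ε` has a `−1` on `U ∩ D_𝔓` this is every place. The complementary case is `ε = 1` on `U ∩ D_𝔓(v̄)`, which on the
line reduces (free re-twist by `χ_{κ₂}`, p708344 `SignTwist`) to **case (B1): `ε = 1` on `D_v̄`**. THIS FILE proves the LEFT disjunct at EVERY
`w′ ∣ v̄` in case (B1):
* `exists_nonsplit_escape` — case (a): if some `u ∈ U ∩ D_v̄` has `ε u ≠ 1`, the RIGHT disjunct of `hB5` holds at EVERY `w′ ∣ v̄`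
  (`𝔓 = g • 𝔓₀` is stabilised by `g u g⁻¹ ∈ U`);
* **`dvd_log_valuation_of_dualShapiro_mem_twisted`** — data of B3d′ / -w3 g14's FILE 2 (`ρ`, `M′`, `B`, `F`, `F′`, `ε`, twisted `m₀`
  (`ρ σ m₀ = ε(σ) • m₀`), `ι′ = B(m₀, ·)` twisted-equivariant, `n • M′ = 0`), the frame input `Γ_K = I_𝔓 · Gal(K̄/F)` for every `𝔓 ∣ v̄`
  (-w3 g14 `forall_exists_inertia_mul_mem_galFixing_layer`) and **`hεD : ε = 1` on `D_v̄`**; conclusion: for all representatives `s`, layer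
  cocycles `φ` satisfying clause (iii) at `v̄` (VERBATIM), Kummer data `ι′(φ u) = uβ/β` on `Gal(K̄/F′)`, `βⁿ = b′ ∈ F′`:
  `(n : ℤ) ∣ log v_{w′}(b′)` for EVERY `w′ : v̄.Extension (𝓞 F′)`.
Route (STATUS 07:55:20Z–08:46Z; -w3 g14 / -w4 g14 split): representatives in `ker ε` (`exists_reps_one_sign`; `Γ_K = I_𝔓₀ U`, `ε(I_𝔓₀) = 1`)
→ the rank-one twist `ℤ/n(ε)` and the twisted probe → the twisted Kummer reading `φY`, `ζ = ∏ s_y β` on `ker ε`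
(`exists_cocycle_twistedKummerReading`, p709686) → -w3 g14's LOCAL reading at `Z = K_ε` (`dvd_log_valuation_of_mem_dualLocalCondition_unramified_of_decompFixed`,
FILE 6: `(n : ℤ) ∣ log v_{w₀}(∏ s_y b′)`) → the transfer to `F′` (`dvd_log_valuation_of_dvd_log_valuation_subfield`, p710167: `u`-nits of `\bar ℤ_{𝔓₀}`,
`[Γ_K : U] ∣ e(w″ ∣ v̄)`, `log v_{w″}(∏ s_y b′) = [Γ_K : U] · log v_{w″}(b′)`) → the conjugate places (`w′ = (u⁻¹|_{F′}) • w″` with `ε u = −1`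
read through p704813 `exists_pow_eq_mul_absRestrictNormalHom`: `ord_{w″}(u b′) ≡ −ord_{w″}(b′)`).
presearch: as p709686/p710167 (NSW (1.5.3)(iv), (1.6.4); Neukirch ANT I §9, II §8; Serre *Local Fields* XIV §1 Prop. 3); no new fact. beyond-print theorem: no.

References: [NeukirchSchmidtWingberg2008] I §5 Prop. (1.5.3)(iv), I §6 (1.6.4), (1.6.6)–(1.6.7); [NeukirchANT1999] Ch. I §9, Ch. II §8–§9;
[SerreLocalFields1979] VII §7, X §3 b), XIV §1 Prop. 3; [GreenbergLNM1716] §4 p. 107; [MilneADT2006] I §2.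
-/

noncomputable section

open scoped Classical Pointwise ContRepresentation

set_option linter.dupNamespace false
set_option autoImplicit false

open CategoryTheory NumberField IsDedekindDomain Field IntermediateField
open Literature.NumberTheory.EllipticCurves Literature.NumberTheory.EllipticCurves.GreenbergSelmer
open Literature.NumberTheory.GaloisRepresentations Literature.NumberTheory.GaloisRepresentations.LocalWeilDatum
open Literature.NumberTheory.GaloisRepresentations.DiscreteGaloisModule (SelmerStructure mu MuCarrier TateDual tateDual
  coindTateDualMor coindTateDualHom unramifiedSubgroup localMap)
open Literature.NumberTheory.GaloisCohomology
open Summit.BirchSwinnertonDyer.Rank1Residual.X11b.LocBridge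

namespace Summit.BirchSwinnertonDyer.BirchSwinnertonDyer.Theorems.PrintCf2.NormAtVbar

/-! ## §1. Case (a): the non-split escape at every place above `v̄` -/

section Escape

variable {K : Type} [Field K] [NumberField K]

set_option synthInstance.maxHeartbeats 160000 in
-- pointwise `Γ_K`-actions on the ideals of `ℤ̄` are found slowly (as in `…KummerUProNullAssembly`)
/-- **The non-split escape at EVERY place above `v̄`.** If some `u ∈ U` (`U ⊴ Γ_K`) with `ε u ≠ 1` lies in the decomposition group `D_v̄`
(= the stabiliser of `𝔓₀ = adicCompletionPrime K v̄`), then for every place `w′ ∣ v̄` of a finite `F′ ⊆ K̄` there is a prime `𝔓 ∣ w′` of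
`\bar ℤ_K` stabilised by some `s ∈ U` with `ε s ≠ 1` (`𝔓 = g • 𝔓₀`, `s = g u g⁻¹`) — the right disjunct of B3d′'s `hB5` / of p705557's `(v̄)`
hypothesis, uniformly in `w′`. [cite: NeukirchANT1999, Ch. I §9 Prop. (9.1)] -/
theorem exists_nonsplit_escape (F' : IntermediateField K (AlgebraicClosure K)) [NumberField F'] (U : Subgroup (absoluteGaloisGroup K)) [U.Normal]
    (ε : absoluteGaloisGroup K →* ℤˣ) (vbar : HeightOneSpectrum (𝓞 K))
    (hu : ∃ u ∈ U, u ∈ GreenbergSelmer.decomp vbar ∧ ε u ≠ 1) (w' : vbar.Extension (𝓞 F')) :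
    ∃ 𝔓 : Ideal (absIntegers (𝓞 K) K),
      𝔓.comap (ringOfIntegersToIntegralClosure (k := K) (Ω := AlgebraicClosure K) F') = w'.1.asIdeal ∧
      ∃ s ∈ U, ε s ≠ 1 ∧ s • 𝔓 = 𝔓 := by
  obtain ⟨u, huU, huD, hεu⟩ := hu
  have h𝔓₀ : adicCompletionPrime K vbar ∈ vbar.primesAbove := adicCompletionPrime_mem_primesAbove K vbar
  -- a prime above `w′`, conjugate to `𝔓₀`
  obtain ⟨𝔓', h𝔓'prime, h𝔓'⟩ := KummerU.exists_prime_absIntegers_comap_eq F' w'.1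
  haveI := h𝔓'prime
  have hunder' : w'.1.asIdeal.under (𝓞 K) = vbar.asIdeal := congrArg HeightOneSpectrum.asIdeal w'.2
  have h𝔓'v : 𝔓' ∈ vbar.primesAbove := by
    refine HeightOneSpectrum.mem_primesAbove_iff.2 ⟨h𝔓'prime, ⟨?_⟩⟩
    rw [Ideal.under_def, KummerU.comap_algebraMap_eq_under_of_comap_eq F' h𝔓', hunder']
  obtain ⟨g, hg⟩ := HeightOneSpectrum.exists_smul_eq_of_mem_primesAbove_holds h𝔓₀ h𝔓'v
  -- `u` stabilises `𝔓₀`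
  have hu𝔓₀ : u • adicCompletionPrime K vbar = adicCompletionPrime K vbar := by
    have h1 : u ∈ (adicCompletionPrime K vbar).decompositionSubgroup (absoluteGaloisGroup K) := by
      rw [decompositionSubgroup_adicCompletionPrime_eq_range]; exact huD
    exact h1
  refine ⟨𝔓', h𝔓', g * u * g⁻¹, Subgroup.Normal.conj_mem inferInstance u huU g, ?_, ?_⟩
  · rwa [map_mul, map_mul, map_inv, mul_inv_cancel_comm]
  · rw [← hg, smul_smul, show g * u * g⁻¹ * g = g * u by group, ← smul_smul, hu𝔓₀]

end Escape

/-! ## §2. Case (B1): the assembled twisted `v̄`-reading -/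

section Assembly

variable {K : Type} [Field K] [NumberField K]
  {M : Type} [AddCommGroup M] [TopologicalSpace M] [DiscreteTopology M] [Finite M] (ρ : DiscreteGaloisModule K M)
  {M' : Type} [AddCommGroup M'] [DistribMulAction (absoluteGaloisGroup K) M'] [TopologicalSpace M'] [DiscreteTopology M']
  (hM' : ∀ m : M', IsOpen {σ : absoluteGaloisGroup K | σ • m = m})
  {n : ℕ} [NeZero n] (B : M →+ M' →+ MuCarrier K n)
  (hB : ∀ (σ : absoluteGaloisGroup K) (m : M) (m' : M'), B (ρ σ m) (ofSMul M' hM' σ m') = mu K n σ (B m m'))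
  (F F' : IntermediateField K (AlgebraicClosure K)) [FiniteDimensional K F'] [IsAbelianGalois K F'] [NumberField F']
  [(galFixing K F).Normal] (hU : IsOpen (galFixing K F : Set (absoluteGaloisGroup K)))
  [Fintype (absoluteGaloisGroup K ⧸ galFixing K F)]
  (ε : absoluteGaloisGroup K →* ℤˣ) (hε : IsOpen ((ε.ker : Subgroup (absoluteGaloisGroup K)) : Set (absoluteGaloisGroup K)))
  (hU' : galFixing K F' ≤ galFixing K F) (hεU' : ∀ u ∈ galFixing K F', ε u = 1)
  (hker : ∀ u ∈ galFixing K F, ε u = 1 → u ∈ galFixing K F')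
  {m₀ : M} (hm₀ : ∀ σ : absoluteGaloisGroup K, ρ σ m₀ = ((ε σ : ℤˣ) : ℤ) • m₀) (hn0 : n • m₀ = 0)
  (hMn' : ∀ x : M', n • x = 0)
  (ι' : M' →+ Additive (AlgebraicClosure K)ˣ) (hι'B : ∀ m' : M', Additive.toMul (ι' m') = muVal K n (B m₀ m'))
  (hι' : ∀ (g : absoluteGaloisGroup K) (x : M'), Additive.toMul (ι' (g • x)) = (g • Additive.toMul (ι' x)) ^ ((ε g : ℤˣ) : ℤ))

include hε hU' hεU' hker hm₀ hn0 hMn' hι'B hι' in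
/-- **B5-T ASSEMBLED (case (B1)).** See the module docstring: under `Γ_K = I_𝔓 · Gal(K̄/F)` for every `𝔓 ∣ v̄` and `ε = 1` on `D_v̄`, clause
(iii) of B2d at `v̄` for the dual-Shapiro class of a layer cocycle `φ` (VERBATIM, any representatives) and twisted Kummer data
`ι′(φ u) = uβ/β` (`u ∈ Gal(K̄/F′)`), `βⁿ = b′ ∈ F′` give `(n : ℤ) ∣ log v_{w′}(b′)` at EVERY place `w′ ∣ v̄` of `F′` — the left disjunct of
B3d′'s `hB5` / of p705557's `(v̄)` hypothesis. [cite: SerreLocalFields1979, XIV §1 Prop. 3] [cite: NeukirchSchmidtWingberg2008, I §5 Prop. (1.5.3)(iv), I §6 (1.6.4)]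
[cite: NeukirchANT1999, Ch. I §9 (9.4), (9.6), Ch. II §8] -/
theorem dvd_log_valuation_of_dualShapiro_mem_twisted (vbar : HeightOneSpectrum (𝓞 K))
    (htot : ∀ 𝔓 ∈ vbar.primesAbove, ∀ σ : absoluteGaloisGroup K,
      ∃ τ ∈ 𝔓.inertia (absoluteGaloisGroup K), τ⁻¹ * σ ∈ galFixing K F)
    (hεD : ∀ σ ∈ GreenbergSelmer.decomp vbar, ε σ = 1)
    {s : absoluteGaloisGroup K ⧸ galFixing K F → absoluteGaloisGroup K}
    (hs : ∀ y, (s y : absoluteGaloisGroup K ⧸ galFixing K F) = y) (hs1 : s ((1 : absoluteGaloisGroup K) : absoluteGaloisGroup K ⧸ galFixing K F) = 1)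
    (φ : contOneCocycles (discreteTopRep (galFixing K F) M'))
    (hvbar : galoisCohomology.localization ((ρ.coind (galFixing K F) hU).tateDual n) (Sum.inr vbar) 1
        (cohomologyMap (coindTateDualMor ρ (ofSMul M' hM') (galFixing K F) B hU hB) 1
          (shapiroLift (ofSMul M' hM').toTopRep (galFixing K F) hU hs hs1 (oneCocycleClass _ φ))) ∈
      (LocalInvariants.canonical K n).dualLocalCondition (ρ.coind (galFixing K F) hU) (Sum.inr vbar)
        (unramifiedSubgroup (GaloisRep.toLocal vbar (ρ.coind (galFixing K F) hU)) 1))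
    (β : (AlgebraicClosure K)ˣ)
    (hβ : ∀ u : galFixing K F', Additive.toMul (ι' (φ.1 ⟨u, hU' u.2⟩)) = (u : absoluteGaloisGroup K) • β / β)
    (b : F') (hb : ((b : F') : AlgebraicClosure K) = ((β ^ n : (AlgebraicClosure K)ˣ) : AlgebraicClosure K))
    (w' : vbar.Extension (𝓞 F')) : (n : ℤ) ∣ WithZero.log (w'.1.valuation F' b) := by
  haveI : IsGalois K (AlgebraicClosure K) := ⟨⟩
  -- ### the prime `𝔓₀` of the chosen embedding, its inertia, and `ε(I_𝔓₀) = 1`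
  have h𝔓₀ : adicCompletionPrime K vbar ∈ vbar.primesAbove := adicCompletionPrime_mem_primesAbove K vbar
  haveI : (adicCompletionPrime K vbar).IsMaximal := adicCompletionPrime_isMaximal K vbar
  have hID : ∀ τ ∈ (adicCompletionPrime K vbar).inertia (absoluteGaloisGroup K), τ ∈ GreenbergSelmer.decomp vbar := by
    intro τ hτ
    have h1 : τ ∈ (adicCompletionPrime K vbar).decompositionSubgroup (absoluteGaloisGroup K) := Ideal.inertia_le_stabilizer _ hτ
    rw [decompositionSubgroup_adicCompletionPrime_eq_range] at h1
    exact h1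
  have hεI : ∀ τ ∈ (adicCompletionPrime K vbar).inertia (absoluteGaloisGroup K), ε τ = 1 := fun τ hτ ↦ hεD τ (hID τ hτ)
  -- `σ = τ · u` with `τ ∈ I_𝔓₀`, `u ∈ U`: every coset of `U` meets `ker ε`, and `ker ε` fixes the place below `𝔓₀`
  have hreps : ∀ g : absoluteGaloisGroup K, ∃ u ∈ galFixing K F, ε (g * u) = 1 := by
    intro g
    obtain ⟨τ, hτ, hτg⟩ := htot _ h𝔓₀ g
    refine ⟨(τ⁻¹ * g)⁻¹, (galFixing K F).inv_mem hτg, ?_⟩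
    rw [show g * (τ⁻¹ * g)⁻¹ = τ by group]
    exact hεI τ hτ
  have hdec : ∀ σ : absoluteGaloisGroup K, ε σ = 1 →
      ∃ τ ∈ (adicCompletionPrime K vbar).inertia (absoluteGaloisGroup K), τ⁻¹ * σ ∈ galFixing K F' := by
    intro σ hσ
    obtain ⟨τ, hτ, hτσ⟩ := htot _ h𝔓₀ σ
    refine ⟨τ, hτ, hker _ hτσ ?_⟩
    rw [map_mul, map_inv, hεI τ hτ, hσ, inv_one, one_mul]
  obtain ⟨s', hs', hs'1, hs'ε⟩ := exists_reps_one_sign (galFixing K F) ε hreps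
  -- clause (iii) is independent of the representatives
  rw [shapiroLift_eq_of_reps (ofSMul M' hM').toTopRep (galFixing K F) hU hs hs1 hs' hs'1] at hvbar
  -- ### the twisted probe and the twisted Kummer reading
  obtain ⟨ρ₁, hρ₁⟩ := exists_signTwistZMod (n := n) ε hε
  obtain ⟨c, hc⟩ := exists_constIntertwining_twisted ρ (galFixing K F) hU ε ρ₁ hρ₁ m₀ hm₀ hn0
  have hβ' : ∀ u : galFixing K F, ε u = 1 → muVal K n (B m₀ (φ.1 u)) = (u : absoluteGaloisGroup K) • β / β := by
    intro u hu
    have hu' : (u : absoluteGaloisGroup K) ∈ galFixing K F' := hker u u.2 hu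
    rw [← hι'B]
    have h := hβ ⟨u, hu'⟩
    exact h
  obtain ⟨φY, hφY, hread⟩ := exists_cocycle_twistedKummerReading ρ hM' B hB F hU hs' hs'1 ε hs'ε hm₀ ρ₁ c hc φ β hβ'
  have hY := localization_mem_dualLocalCondition_of_dualShapiro_mem ρ hM' B hB F hU hs' hs'1 ρ₁ c vbar φ hvbar φY hφY
  have hloc : ∀ (σ : absoluteGaloisGroup (vbar.adicCompletion K)) (m : ZMod n),
      ρ₁ (absGaloisRestrict K (vbar.adicCompletion K) σ) m = m := fun σ m ↦ by
    rw [hρ₁, hεD _ ((GreenbergSelmer.mem_decomp_iff vbar _).2 ⟨σ, rfl⟩), Units.val_one, one_zsmul]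
  -- ### the sign field `Z = K_ε`
  obtain ⟨Z, hZ, -, hZfin, hZab, hZnf, -⟩ :=
    KummerUDict.exists_intermediateField_galFixing_eq_inf_ker (⊥ : IntermediateField K (AlgebraicClosure K)) ε hε
  haveI := hZfin
  haveI := hZab
  haveI := hZnf
  have hZker : ∀ σ : absoluteGaloisGroup K, σ ∈ galFixing K Z ↔ ε σ = 1 := fun σ ↦ by
    rw [hZ, Subgroup.mem_inf, MonoidHom.mem_ker]
    exact ⟨fun h ↦ h.2, fun h ↦ ⟨(mem_galFixing_iff K).2 fun x hx ↦ by
      rw [IntermediateField.mem_bot] at hx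
      obtain ⟨a, rfl⟩ := hx
      rw [absoluteGaloisGroup.smul_def, AlgEquiv.commutes], h⟩⟩
  have hDZ : ∀ σ : absoluteGaloisGroup (vbar.adicCompletion K), absGaloisRestrict K (vbar.adicCompletion K) σ ∈ galFixing K Z :=
    fun σ ↦ (hZker _).2 (hεD _ ((GreenbergSelmer.mem_decomp_iff vbar _).2 ⟨σ, rfl⟩))
  have hIZ : ∀ 𝔓 ∈ vbar.primesAbove, 𝔓.inertia (absoluteGaloisGroup K) ≤ galFixing K Z := by
    intro 𝔓 h𝔓 τ hτ
    obtain ⟨g, hg⟩ := HeightOneSpectrum.exists_smul_eq_of_mem_primesAbove_holds h𝔓₀ h𝔓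
    rw [← hg, KummerU.mem_inertia_pointwise_smul_iff] at hτ
    refine (hZker τ).2 ?_
    have h := hεI _ hτ
    rwa [map_mul, map_mul, map_inv, mul_right_comm, inv_mul_cancel, one_mul] at h
  obtain ⟨w₀, hw₀, -⟩ := exists_heightOneSpectrum_comap_eq Z (adicCompletionPrime K vbar) h𝔓₀
  -- `z := ∏_y s′_y • b′ ∈ Z` and `ζ := ∏_y s′_y • β`
  have hbfix : ∀ u : galFixing K F, ε u = 1 → (u : absoluteGaloisGroup K) • ((b : F') : AlgebraicClosure K) = b := fun u hu ↦
    (mem_galFixing_iff K).1 (hker u u.2 hu) _ b.2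
  have hxfix : ∀ g : galFixing K Z, (g : absoluteGaloisGroup K) •
      (∏ y : absoluteGaloisGroup K ⧸ galFixing K F, (s' y) • ((b : F') : AlgebraicClosure K)) =
      ∏ y : absoluteGaloisGroup K ⧸ galFixing K F, (s' y) • ((b : F') : AlgebraicClosure K) := fun g ↦
    smul_prod_smul_eq_of_sign_eq_one F hs' ε hs'ε _ hbfix ((hZker _).1 g.2)
  obtain ⟨z, hz⟩ := galFixing.exists_algebraMap_eq_of_forall_smul_eq Z hxfix
  have hζ : (((∏ y : absoluteGaloisGroup K ⧸ galFixing K F, (s' y) • β) ^ n : (AlgebraicClosure K)ˣ) : AlgebraicClosure K) =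
      ((z : Z) : AlgebraicClosure K) := by
    rw [coe_pow_prod_smul F β _ hb]
    exact hz.symm
  have hreadZ : ∀ g ∈ galFixing K Z, muVal K n ((φY.1 g) 1) =
      g • (∏ y : absoluteGaloisGroup K ⧸ galFixing K F, (s' y) • β) / ∏ y : absoluteGaloisGroup K ⧸ galFixing K F, (s' y) • β :=
    fun g hg ↦ hread g ((hZker g).1 hg)
  -- ### -w3 g14's local reading at `Z`
  have hdivZ : (n : ℤ) ∣ WithZero.log (w₀.valuation Z z) :=
    dvd_log_valuation_of_mem_dualLocalCondition_unramified_of_decompFixed K ρ₁ vbar hloc φY hY Z hDZ hIZ w₀ hw₀ z _ hζ hreadZ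
  -- ### transfer to the place `w″` of `F′` below `𝔓₀`
  obtain ⟨w₁, hw₁, -⟩ := exists_heightOneSpectrum_comap_eq F' (adicCompletionPrime K vbar) h𝔓₀
  -- `e(w₀ ∣ v̄) = 1`
  have he₀ : vbar.asIdeal.ramificationIdx' w₀.asIdeal = 1 := by
    haveI := h𝔓₀.1
    haveI := vbar.isPrime
    have hunder₀ : w₀.asIdeal.under (𝓞 K) = vbar.asIdeal := by
      rw [← KummerU.comap_algebraMap_eq_under_of_comap_eq Z hw₀]; exact h𝔓₀.2.over.symm
    haveI : w₀.asIdeal.LiesOver vbar.asIdeal := ⟨hunder₀.symm⟩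
    have hunr : Algebra.IsUnramifiedIn (𝓞 Z) vbar.asIdeal := by
      rw [Literature.NumberTheory.NumberFields.isUnramifiedIn_iff_forall_inertia_absRestrictNormalHom_eq_one Z vbar]
      intro 𝔓 h𝔓 g hg
      have hker1 : absRestrictNormalHom Z g = 1 ↔ g ∈ galFixing K Z :=
        (MonoidHom.mem_ker (f := AlgEquiv.restrictNormalHom Z)).symm.trans (SetLike.ext_iff.mp (IntermediateField.restrictNormalHom_ker Z) g)
      exact hker1.2 (hIZ 𝔓 h𝔓 hg)
    rw [Ideal.ramificationIdx'_eq_ramificationIdx vbar.asIdeal w₀.asIdeal vbar.ne_bot]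
    exact hunr.ramificationIdx_eq_one inferInstance
  -- `d = [Γ_K : U] ∣ e(w″ ∣ v̄)`, `d ≠ 0`
  have hde : (galFixing K F).index ∣ vbar.asIdeal.ramificationIdx' w₁.asIdeal :=
    index_dvd_ramificationIdx F F' hU' h𝔓₀ w₁ hw₁ (htot _ h𝔓₀)
  have hd : (galFixing K F).index ≠ 0 := by
    rw [Subgroup.index_eq_card, Nat.card_eq_fintype_card]
    exact Fintype.card_ne_zero
  -- every `s′_y` (indeed every element of `ker ε`) fixes `w″`
  have hfixker : ∀ σ : absoluteGaloisGroup K, ε σ = 1 → absRestrictNormalHom F' σ • w₁ = w₁ := by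
    intro σ hσ
    obtain ⟨τ, hτ, hτσ⟩ := hdec σ hσ
    have hker1 : absRestrictNormalHom F' (τ⁻¹ * σ) = 1 :=
      ((MonoidHom.mem_ker (f := AlgEquiv.restrictNormalHom F')).symm.trans
        (SetLike.ext_iff.mp (IntermediateField.restrictNormalHom_ker F') (τ⁻¹ * σ))).2 hτσ
    have hστ : absRestrictNormalHom F' σ = absRestrictNormalHom F' τ := by
      rw [map_mul, map_inv, inv_mul_eq_one] at hker1
      exact hker1.symm
    rw [hστ]
    exact KummerUDict.absRestrictNormalHom_smul_eq_of_mem_inertia F' w₁ _ hw₁ hτ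
  -- `z` read in `F′`: `x = ∏_y (s′_y|_{F′}) b′`, `log v_{w″}(x) = d · log v_{w″}(b′)`
  set x : F' := ∏ y : absoluteGaloisGroup K ⧸ galFixing K F, absRestrictNormalHom F' (s' y) b with hxdef
  have hzx : ((z : Z) : AlgebraicClosure K) = ((x : F') : AlgebraicClosure K) := by
    rw [hxdef, coe_prod_absRestrictNormalHom_smul F F' b, ← hz]
    rfl
  have hx : WithZero.log (w₁.valuation F' x) = ((galFixing K F).index : ℤ) * WithZero.log (w₁.valuation F' b) := by
    rw [hxdef, log_valuation_prod_eq F' w₁ (fun y ↦ absRestrictNormalHom F' (s' y)) (fun y ↦ hfixker _ (hs'ε y)) b,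
      Subgroup.index_eq_card, Nat.card_eq_fintype_card]
  have hb0 : b ≠ 0 := by
    intro h
    rw [h] at hb
    exact (β ^ n).ne_zero (hb.symm.trans (ZeroMemClass.coe_zero F'))
  have hx0 : x ≠ 0 := by
    rw [hxdef]
    exact Finset.prod_ne_zero_iff.2 fun y _ ↦ (map_ne_zero _).2 hb0
  have hz0 : z ≠ 0 := by
    intro h
    apply hx0
    have h1 : ((x : F') : AlgebraicClosure K) = 0 := by rw [← hzx, h]; rfl
    exact_mod_cast h1
  -- ### the place `w″`: `n ∣ log v_{w″}(b′)`
  have hw₁dvd : (n : ℤ) ∣ WithZero.log (w₁.valuation F' b) :=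
    dvd_log_valuation_of_dvd_log_valuation_subfield Z F' (adicCompletionPrime K vbar) h𝔓₀ w₀ hw₀ w₁ hw₁ he₀ hd hde hz0 hzx hx hdivZ
  -- ### an arbitrary place `w′ ∣ v̄`: `w′ = (u⁻¹|_{F′}) • w″` with `u ∈ U`
  obtain ⟨𝔓', h𝔓'prime, h𝔓'⟩ := KummerU.exists_prime_absIntegers_comap_eq F' w'.1
  haveI := h𝔓'prime
  have hunder' : w'.1.asIdeal.under (𝓞 K) = vbar.asIdeal := congrArg HeightOneSpectrum.asIdeal w'.2
  have h𝔓'v : 𝔓' ∈ vbar.primesAbove := by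
    refine HeightOneSpectrum.mem_primesAbove_iff.2 ⟨h𝔓'prime, ⟨?_⟩⟩
    rw [Ideal.under_def, KummerU.comap_algebraMap_eq_under_of_comap_eq F' h𝔓', hunder']
  obtain ⟨σ, hσ⟩ := HeightOneSpectrum.exists_smul_eq_of_mem_primesAbove_holds h𝔓₀ h𝔓'v
  have hw'eq : w'.1 = absRestrictNormalHom F' σ • w₁ := by
    apply HeightOneSpectrum.ext
    rw [← comap_smul_eq_smul_asIdeal F' w₁ _ hw₁ σ, hσ, h𝔓']
  obtain ⟨u, huU, hεσu⟩ := hreps σ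
  have hcomm : ∀ a c : F' ≃ₐ[K] F', a * c = c * a := fun a c ↦ IsMulCommutative.is_comm.comm a c
  have hw'eq' : w'.1 = absRestrictNormalHom F' u⁻¹ • w₁ := by
    rw [hw'eq, show σ = σ * u * u⁻¹ by group, map_mul, hcomm, mul_smul, hfixker _ hεσu]
  rw [hw'eq', valuation_smul_place F', map_inv, inv_inv]
  -- ### the two cases `ε u = ±1`
  rcases Int.units_eq_one_or (ε u) with hu | hu
  · -- `u` itself fixes `w″`
    have hfix : absRestrictNormalHom F' u • w₁ = w₁ := hfixker u hu
    have h := Literature.NumberTheory.Automorphic.HeightOneSpectrum.valuation_algEquiv_smul K (absRestrictNormalHom F' u) w₁ b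
    rw [hfix] at h
    rw [h]
    exact hw₁dvd
  · -- `ε u = −1`: `b′ · (u|_{F′}) b′` is an `n`-th power (p704813)
    let cc : absoluteGaloisGroup K → (AlgebraicClosure K)ˣ := fun g ↦
      if hg : g ∈ galFixing K F then Additive.toMul (ι' (φ.1 ⟨g, hg⟩)) else 1
    have hcc : ∀ g (hg : g ∈ galFixing K F), cc g = Additive.toMul (ι' (φ.1 ⟨g, hg⟩)) := fun g hg ↦ dif_pos hg
    have hcoc : ∀ g ∈ galFixing K F, ∀ h ∈ galFixing K F, cc (g * h) = cc g * (g • cc h) ^ ((ε g : ℤˣ) : ℤ) := by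
      intro g hg h hh
      rw [hcc g hg, hcc h hh, hcc (g * h) ((galFixing K F).mul_mem hg hh)]
      have hφ := φ.2 ⟨g, hg⟩ ⟨h, hh⟩
      have e1 : (⟨g, hg⟩ * ⟨h, hh⟩ : galFixing K F) = ⟨g * h, (galFixing K F).mul_mem hg hh⟩ := rfl
      rw [e1] at hφ
      rw [hφ, map_add, toMul_add, ← hι' g]
      rfl
    have hεu : ((ε u : ℤˣ) : ℤ) = -1 := by rw [hu]; rfl
    have hcs : cc u ^ n = 1 := by
      rw [hcc u huU, ← toMul_nsmul, ← map_nsmul, hMn', map_zero, toMul_zero]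
    have hβ0 : (β : AlgebraicClosure K) ≠ 0 := β.ne_zero
    have hres : ∀ u' ∈ galFixing K F', (cc u' : AlgebraicClosure K) = u' • (β : AlgebraicClosure K) / β := by
      intro u' hu'
      rw [hcc u' (hU' hu'), hβ ⟨u', hu'⟩, Units.val_div_eq_div_val, Units.coe_smul]
    have hb' : algebraMap F' (AlgebraicClosure K) b = (β : AlgebraicClosure K) ^ n := by
      rw [IntermediateField.algebraMap_apply, hb, Units.val_pow_eq_pow_val]
    obtain ⟨dd, hdd⟩ := KummerUDict.exists_pow_eq_mul_absRestrictNormalHom (galFixing K F) ε F' hU' hεU' hker hcoc huU hεu hcs hβ0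
      hres hb'
    have hc0 : absRestrictNormalHom F' u b ≠ 0 := (map_ne_zero _).2 hb0
    exact dvd_log_valuation_of_pow_eq_mul F' w₁ hb0 hc0 hdd hw₁dvd

end Assembly

end Summit.BirchSwinnertonDyer.BirchSwinnertonDyer.Theorems.PrintCf2.NormAtVbar

end
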